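import Mathlib
import Literature.Probability.LatticeModels.TriangularLattice
import HarnessLib

/-!
# Stub `stub_siteEndCrossings` (S7a) of line `Sketch`, crux `LoopLimitZ2EqT` (stmt-CriticalPhenomena-4833):
# run extraction for lattice chains crossing a planar domain ("the port")

Helper file (`--supports stmt-CriticalPhenomena-4833`) for the crossing-level endpoint dictionary at
`t = 0` (`stub_siteEndCrossings`: Cardy's formula for the crude crossing probabilities
`segCross 0 R δ` of the all-or-nothing model `M₀`). Both halves of that proof compare the crude
embedded crossing event `embDomainCrossing` of a conformal rectangle with a crossing event of a
comparison rectangle in Bollobás–Riordan sandwich position (B. Bollobás, O. Riordan, *Percolation*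
(2006), Ch. 7, Lemma 14 p. 184, Claim 19 p. 192 and the remark p. 195), through ONE deterministic
statement proved here, free of percolation and of plane topology:

* `siteEndCrossings_run` — abstract run extraction: along a chain whose elements are of three
  mutually exclusive kinds `In`, `O₀`, `O₂`, with no step from an `O₀` element to an `O₂` element,
  starting at an `O₀` element and ending at an `O₂` element, there is a run of `In` elements entered
  from an `O₀` element and left to an `O₂` element (head induction).
* `siteEndCrossings_port` — the metric port: a chain of lattice points of `δ𝕋` (consecutive points
  within `δ`) from a point off the open set `Ω`, `t`-close to `A`, to a point off `Ω`, `t`-close to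
  `B`, all of whose points off `Ω` are `t`-close to `A` or to `B` and all of whose points in `Ω` are
  more than `δ` away from `C`, where `∂Ω ⊆ A ∪ B ∪ C` and `dist(A, B) > 2t + 2δ`, contains a run of
  points of `Ω` starting within `δ` of `A` and ending within `δ` of `B` (the entry and exit steps
  cross `∂Ω` on `A`, resp. `B`: `exists_mem_frontier_infDist_compl_eq_dist`).
-/

noncomputable section

open Set Metric

namespace Summit.CriticalPhenomena.CardyFormulaZ2.Cruxes.LoopLimitZ2EqT.HexSegment

open Literature.Probability.LatticeModels

/-! ### Abstract run extraction -/

/-- **Run extraction.** Along a chain (reflexive–transitive closure of `Rel`, every visited element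
of kind `In`, `O₀` or `O₂`; the kinds are mutually exclusive and no `Rel`-step leads from an `O₀`
element to an `O₂` element) ending at an `O₂` element: if it starts at an `O₀` element it contains a
run of `In` elements entered by a `Rel`-step from an `O₀` element and left by a `Rel`-step to an `O₂`
element; if it starts at an `In` element, either it contains such a run or its initial `In`-run is
left directly to an `O₂` element. -/
theorem siteEndCrossings_run {α : Type*} {Rel : α → α → Prop} {In O₀ O₂ : α → Prop}
    (hex2 : ∀ a, O₂ a → ¬ In a) (h02 : ∀ a, O₀ a → ¬ O₂ a)
    (hstep : ∀ a b, Rel a b → O₀ a → O₂ b → False) {a z : α}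
    (h : Relation.ReflTransGen (fun a b => Rel a b ∧ (In b ∨ O₀ b ∨ O₂ b)) a z) (hz : O₂ z) :
    (O₀ a → ∃ o p q o', O₀ o ∧ Rel o p ∧ In p ∧
        Relation.ReflTransGen (fun a b => Rel a b ∧ In b) p q ∧ Rel q o' ∧ O₂ o') ∧
    (In a → (∃ o p q o', O₀ o ∧ Rel o p ∧ In p ∧
        Relation.ReflTransGen (fun a b => Rel a b ∧ In b) p q ∧ Rel q o' ∧ O₂ o') ∨
      ∃ q o', Relation.ReflTransGen (fun a b => Rel a b ∧ In b) a q ∧ Rel q o' ∧ O₂ o') := by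
  induction h using Relation.ReflTransGen.head_induction_on with
  | refl => exact ⟨fun h0 => (h02 _ h0 hz).elim, fun hi => (hex2 _ hz hi).elim⟩
  | head hab _ ih =>
    rename_i a' b _
    obtain ⟨hrel, hkind⟩ := hab
    obtain ⟨ih0, ihI⟩ := ih
    refine ⟨fun h0 => ?_, fun hi => ?_⟩
    · rcases hkind with hb | hb | hb
      · rcases ihI hb with hrun | ⟨q, o', hch, hq, ho'⟩
        · exact hrun
        · exact ⟨a', b, q, o', h0, hrel, hb, hch, hq, ho'⟩
      · exact ih0 hb
      · exact (hstep _ _ hrel h0 hb).elim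
    · rcases hkind with hb | hb | hb
      · rcases ihI hb with hrun | ⟨q, o', hch, hq, ho'⟩
        · exact Or.inl hrun
        · exact Or.inr ⟨q, o', Relation.ReflTransGen.head ⟨hrel, hb⟩ hch, hq, ho'⟩
      · exact Or.inl (ih0 hb)
      · exact Or.inr ⟨a', b, Relation.ReflTransGen.refl, hrel, hb⟩

/-- The last element of a chain all of whose steps land in `P` satisfies `P` (if the first does). -/
theorem siteEndCrossings_last_of_chain {α : Type*} {Rel : α → α → Prop} {P : α → Prop} {a z : α}
    (h : Relation.ReflTransGen (fun a b => Rel a b ∧ P b) a z) (ha : P a) : P z := by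
  induction h with
  | refl => exact ha
  | tail _ hbc _ => exact hbc.2

/-! ### The metric port -/

/-- **Two points `t`-close to `A` and to `B` are more than `2δ` apart** when `dist(A, B) > 2t + 2δ`. -/
theorem siteEndCrossings_far {A B : Set ℂ} {δ t d : ℝ} (hA : A.Nonempty) (hB : B.Nonempty)
    (hd : ∀ a ∈ A, ∀ b ∈ B, d < dist a b) (htd : 2 * t + 2 * δ < d) {z w : ℂ}
    (hz : infDist z A ≤ t) (hw : infDist w B ≤ t) : 2 * δ < dist z w := by
  by_contra hle
  push Not at hle
  set η := (d - 2 * t - 2 * δ) / 2 with hη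
  have hη0 : 0 < η := by rw [hη]; linarith
  obtain ⟨a, ha, hza⟩ := (infDist_lt_iff hA).1 (show infDist z A < t + η by linarith)
  obtain ⟨b, hb, hwb⟩ := (infDist_lt_iff hB).1 (show infDist w B < t + η by linarith)
  have h1 := hd a ha b hb
  have h2 := dist_triangle4 a z w b
  rw [dist_comm] at hza
  linarith

/-- **The metric port (run extraction for lattice chains crossing a planar domain).** Let
`Ω ≠ ℂ` with `∂Ω ⊆ A ∪ B ∪ C`, `dist(A, B) > 2t + 2δ`. Consider a chain of points of `δ𝕋` from `u` to
`v` (consecutive points `Rel`-related, hence within `δ`; every visited point `Good`) such that every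
good point off `Ω` is `t`-close to `A` or to `B`, every good point in `Ω` is more than `δ` away from
`C`, `u` is off `Ω` and `t`-close to `A`, `v` is off `Ω` and `t`-close to `B`. Then the chain contains
a run of good points of `Ω`, starting within `δ` of `A` and ending within `δ` of `B`: the run of
`siteEndCrossings_run`; its entry step, from a point off `Ω` near `A` to a point of `Ω`, passes within
`δ` of a frontier point (`exists_mem_frontier_infDist_compl_eq_dist`), which lies neither on `B` (too
far from `A`) nor on `C` (too close to a good point of `Ω`), hence on `A`; symmetrically for the exit.
(Bollobás–Riordan, *Percolation* (2006), Ch. 7, Claim 19 p. 192, metric skeleton.) -/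
theorem siteEndCrossings_port : ∀ {Ω A B C : Set ℂ}, Ω ≠ univ → frontier Ω ⊆ A ∪ B ∪ C → A.Nonempty → B.Nonempty →
    ∀ {δ t d : ℝ}, 0 < δ → (∀ a ∈ A, ∀ b ∈ B, d < dist a b) → 2 * t + 2 * δ < d →
    ∀ {Rel : Site 2 → Site 2 → Prop} {Good : Site 2 → Prop},
    (∀ a b, Rel a b → dist (triMeshPoint δ a) (triMeshPoint δ b) ≤ δ) →
    (∀ a, Good a → triMeshPoint δ a ∉ Ω → infDist (triMeshPoint δ a) A ≤ t ∨ infDist (triMeshPoint δ a) B ≤ t) →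
    (∀ a, Good a → triMeshPoint δ a ∈ Ω → ∀ q ∈ C, δ < dist q (triMeshPoint δ a)) →
    ∀ {u v : Site 2}, Good u → Relation.ReflTransGen (fun a b => Rel a b ∧ Good b) u v →
    triMeshPoint δ u ∉ Ω → infDist (triMeshPoint δ u) A ≤ t → triMeshPoint δ v ∉ Ω → infDist (triMeshPoint δ v) B ≤ t →
    ∃ p q, Good p ∧ triMeshPoint δ p ∈ Ω ∧ infDist (triMeshPoint δ p) A ≤ δ ∧
      Relation.ReflTransGen (fun a b => Rel a b ∧ Good b ∧ triMeshPoint δ b ∈ Ω) p q ∧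
      triMeshPoint δ q ∈ Ω ∧ infDist (triMeshPoint δ q) B ≤ δ := by
  intro Ω A B C hΩ' hfr hA hB δ t d hδ hd htd Rel Good hRel hclass hq u v hu hchain huΩ huA hvΩ hvB
  have ht0 : 0 ≤ t := infDist_nonneg.trans huA
  have far : ∀ {z w : ℂ}, infDist z A ≤ t → infDist w B ≤ t → 2 * δ < dist z w := fun hz hw =>
    siteEndCrossings_far hA hB hd htd hz hw
  -- the three kinds
  set In : Site 2 → Prop := fun a => Good a ∧ triMeshPoint δ a ∈ Ω with hIn
  set O₀ : Site 2 → Prop := fun a => Good a ∧ triMeshPoint δ a ∉ Ω ∧ infDist (triMeshPoint δ a) A ≤ t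
    with hO₀
  set O₂ : Site 2 → Prop := fun a => Good a ∧ triMeshPoint δ a ∉ Ω ∧ infDist (triMeshPoint δ a) B ≤ t
    with hO₂
  have hex2 : ∀ a, O₂ a → ¬ In a := fun a h2 hi => h2.2.1 hi.2
  have h02 : ∀ a, O₀ a → ¬ O₂ a := fun a h0 h2 => by
    have := far h0.2.2 h2.2.2
    rw [dist_self] at this
    linarith
  have hstep : ∀ a b, Rel a b → O₀ a → O₂ b → False := fun a b hab h0 h2 => by
    have h1 := far h0.2.2 h2.2.2
    have h3 := hRel a b hab
    have h4 : (0 : ℝ) ≤ dist (triMeshPoint δ a) (triMeshPoint δ b) := dist_nonneg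
    linarith
  -- the chain, read with kinds
  have hchain' : Relation.ReflTransGen (fun a b => Rel a b ∧ (In b ∨ O₀ b ∨ O₂ b)) u v := by
    refine Relation.ReflTransGen.mono ?_ u v hchain
    rintro a b hab
    refine ⟨hab.1, ?_⟩
    by_cases hb : triMeshPoint δ b ∈ Ω
    · exact Or.inl ⟨hab.2, hb⟩
    · rcases hclass b hab.2 hb with h | h
      · exact Or.inr (Or.inl ⟨hab.2, hb, h⟩)
      · exact Or.inr (Or.inr ⟨hab.2, hb, h⟩)
  have hv : Good v := siteEndCrossings_last_of_chain hchain hu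
  obtain ⟨o, p, q, o', ho, hop, hp, hrun, hqo', ho'⟩ :=
    (siteEndCrossings_run hex2 h02 hstep hchain' ⟨hv, hvΩ, hvB⟩).1 ⟨hu, huΩ, huA⟩
  have hqIn : In q := siteEndCrossings_last_of_chain hrun hp
  -- entry and exit cross the frontier on `A`, resp. `B`
  have cross : ∀ {a b : Site 2}, Rel a b ∨ Rel b a → triMeshPoint δ a ∉ Ω → In b →
      ∃ y ∈ frontier Ω, dist (triMeshPoint δ b) y ≤ δ ∧ dist (triMeshPoint δ a) y ≤ 2 * δ ∧ y ∉ C := by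
    intro a b hab ha hb
    obtain ⟨y, hy, hyd⟩ := exists_mem_frontier_infDist_compl_eq_dist hb.2 hΩ'
    have hab' : dist (triMeshPoint δ a) (triMeshPoint δ b) ≤ δ := by
      rcases hab with hab | hab
      · exact hRel a b hab
      · rw [dist_comm]; exact hRel b a hab
    have h1 : dist (triMeshPoint δ b) y ≤ δ := by
      rw [← hyd]
      exact (infDist_le_dist_of_mem (mem_compl ha)).trans (by rwa [dist_comm])
    refine ⟨y, hy, h1, by linarith [dist_triangle (triMeshPoint δ a) (triMeshPoint δ b) y], fun hyC => ?_⟩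
    have := hq b hb.1 hb.2 y hyC
    rw [dist_comm] at this
    linarith
  have hpA : infDist (triMeshPoint δ p) A ≤ δ := by
    obtain ⟨y, hy, hyp, hyo, hyC⟩ := cross (Or.inl hop) ho.2.1 hp
    rcases hfr hy with (hyA | hyB) | hyC'
    · exact (infDist_le_dist_of_mem hyA).trans hyp
    · have := far ho.2.2 (show infDist y B ≤ t by rw [infDist_zero_of_mem hyB]; exact ht0)
      linarith
    · exact (hyC hyC').elim
  have hqB : infDist (triMeshPoint δ q) B ≤ δ := by
    obtain ⟨y, hy, hyq, hyo, hyC⟩ := cross (Or.inr hqo') ho'.2.1 hqIn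
    rcases hfr hy with (hyA | hyB) | hyC'
    · have := far (show infDist y A ≤ t by rw [infDist_zero_of_mem hyA]; exact ht0) ho'.2.2
      rw [dist_comm] at hyo
      linarith
    · exact (infDist_le_dist_of_mem hyB).trans hyq
    · exact (hyC hyC').elim
  exact ⟨p, q, hp.1, hp.2, hpA, hrun, hqIn.2, hqB⟩

end Summit.CriticalPhenomena.CardyFormulaZ2.Cruxes.LoopLimitZ2EqT.HexSegment

end
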